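import Summits.Ventures.LatticeQCDFlow.Exactness.FreeFieldHMCMagnetisationCSD
import HarnessLib

/-!
# Randomised trajectory lengths: the HMC update with `N` drawn at random is exact, reversible, and obeys the AVERAGED mean-squared-jump floor

HONEST FRAMING: exact (Metropolis-corrected) sampling algorithms for lattice gauge theory;
figures of merit are autocorrelation/cost numbers at stated couplings and volumes; no
continuum-physics claim.  (SCALAR calibration rung S0-A: not a gauge result.)

Venture `LatticeQCDFlow` (cell pub-lqcd), topic `Exactness`; FANOUT row 2 (`s0-phi4`, HMC arm).
NEW WORK of the cell over row 2's `Phi4HMCPolyObs*` files (the HMC update as a reversible Markov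
`L²(e^{−S})`-contraction on the polynomial class) and `FreeFieldHMCMagnetisationCSD` (the coercive
mean-squared-jump floor).  Nothing is cited as a fact.  Printed counterpart, NAMED ONLY: Mackenzie
1989 (Phys. Lett. B 226, 369: randomised trajectory lengths against the resonances of HMC).

Setting: lattice φ⁴ on `V = n + 1` sites, `S = Σ φJφ + λΣφ⁴` coercive (`εΣφ² − K ≤ S`, any real
`λ`, `J`); row 2's exact HMC update `K_N = hmcOpPhi4 J λ δ N` (refresh, `N` qpq leapfrog steps of
size `δ`, flip, Metropolis test); a finite set `S` of trajectory lengths with weights `w_N ≥ 0`,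
`Σ_{N∈S} w_N = 1`.  ONE RANDOMISED UPDATE draws `N ∼ w`, then runs `K_N`:

* `hmcOpRandom J λ δ S w f = Σ_{N∈S} w_N · K_N f` (definition; the law of `N` is drawn afresh at
  every update, independently of the state — the standard randomisation);
* `polyObs_finsetSum`, **`polyObs_hmcOpRandom`**, `hmcOpRandom_add_mul`, `hmcOpRandom_one` — the
  randomised update maps the polynomial class to itself, linearly, with `K̄1 = 1`;
* **`hmcOpRandom_exact`** — EXACTNESS: `∫ (K̄ f) e^{−S} = ∫ f e^{−S}` for every `f ∈ PolyObs` (each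
  `K_N` is exact: `hmc_exact_of_involutive`);
* **`hmcOpRandom_reversible`**, **`hmcOpRandom_contraction`** — `K̄` is `e^{−S}`-symmetric and an
  `L²(e^{−S})`-contraction on `PolyObs` (convexity: `(Σ w_N a_N)² ≤ Σ w_N a_N²`);
* `hmcOpOf_sqdev_expand`, `integrable_hmcOpOf_sqdev`, **`hmcOpRandom_carre_eq`** — its integrated
  carré du champ is the `w`-AVERAGE of the phase-space mean squared accepted jumps:
  `∫ K̄[(g − g φ)²](φ) e^{−S} = Σ_N w_N ∫∫ a_N (g((Ψ_N z).1) − g(z.1))² e^{−H} / Z_p`;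
* **`hmcRandom_tauInt_ge_of_msd_le`** — THE AVERAGED FLOOR: if for each `N ∈ S` the mean squared
  accepted jump of `f ∈ PolyObs` obeys `∫∫ a_N (Δ_N f)² e^{−H} ≤ D_N Z_p Z`, and `g = f − ⟨f⟩` has
  summable autocorrelations with `ρ_g(1) < 1` under `K̄`, then
  `τ_int(f) ≥ 2 Var(f)/(Σ_N w_N D_N) − ½`.

Reading (no numerics implied): randomising the trajectory length averages the DENOMINATOR of the
floor, nothing more — every per-`N` jump bound of the tree (`Phi4HMCActionCSD`: `16/e² + 4V` for the
action; `Phi4HMCOneStepCSD`; the free field's `V(1 − cos Nθ)/m²`, `FreeFieldHMCMagnetisationCSD`)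
passes to the randomised algorithm with `D ↦ E_w[D_N]` (`FreeFieldRandomisedHMCCSD` draws the
free-field consequence `τ_int(M) ≥ 1/E_w[1 − cos Nθ] − ½ ≥ ξ²/(δ² E_w[N²]) − ½`).  NOT CLAIMED:
`ρ_g(1) < 1` / summability for any run; state-dependent randomisation; partial momentum refreshment.
-/

namespace Summit.Ventures.LatticeQCDFlow.Exactness

open Real MeasureTheory Filter Finset
open Summit.Ventures.LatticeQCDFlow.Scoring

section Random

variable {n : ℕ}

/-- **ONE HMC UPDATE WITH A RANDOMISED TRAJECTORY LENGTH**: draw `N` from the finitely supported law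
`w` on `S ⊂ ℕ` (independently of the state), then run row 2's exact update `hmcOpPhi4 J λ δ N`
(refresh, `N` qpq leapfrog steps, flip, Metropolis test).  As an operator on observables:
`K̄ f = Σ_{N∈S} w_N · K_N f`.  Randomised trajectory lengths: Mackenzie, Phys. Lett. B 226 (1989)
369, named only. [folklore] -/
@[folklore]
noncomputable def hmcOpRandom (J : Fin (n + 1) → Fin (n + 1) → ℝ) (lam δ : ℝ) (S : Finset ℕ)
    (w : ℕ → ℝ) (f : (Fin (n + 1) → ℝ) → ℝ) (φ : Fin (n + 1) → ℝ) : ℝ :=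
  ∑ N ∈ S, w N * hmcOpPhi4 J lam δ N f φ

/-- The polynomial class is closed under finite weighted sums. -/
theorem polyObs_finsetSum {ι : Type*} (s : Finset ι) (c : ι → ℝ)
    {F : ι → (Fin (n + 1) → ℝ) → ℝ} (hF : ∀ i ∈ s, PolyObs (F i)) :
    PolyObs (fun φ => ∑ i ∈ s, c i * F i φ) := by
  classical
  induction s using Finset.induction_on with
  | empty =>
      simp only [Finset.sum_empty]
      exact polyObs_const 0
  | @insert a s ha ih =>
      have h := polyObs_add_mul (ih fun i hi => hF i (Finset.mem_insert_of_mem hi))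
        (hF a (Finset.mem_insert_self a s)) (c a)
      refine (show (fun φ => ∑ i ∈ insert a s, c i * F i φ)
        = fun φ => (∑ i ∈ s, c i * F i φ) + c a * F a φ from funext fun φ => ?_) ▸ h
      rw [Finset.sum_insert ha, add_comm]

/-- **The randomised update maps `PolyObs` to itself** (every `J`, `λ`, `δ`, `S`, `w`). -/
theorem polyObs_hmcOpRandom (J : Fin (n + 1) → Fin (n + 1) → ℝ) (lam δ : ℝ) (S : Finset ℕ)
    (w : ℕ → ℝ) {f : (Fin (n + 1) → ℝ) → ℝ} (hf : PolyObs f) :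
    PolyObs (hmcOpRandom J lam δ S w f) := by
  unfold hmcOpRandom
  refine polyObs_finsetSum S w fun N _ => ?_
  obtain ⟨C, hC1, hCg⟩ := hmcProposal_growth J lam δ N
  exact polyObs_hmcOpOf J lam (measurable_hmcProposal J lam δ N) (zero_le_one.trans hC1) hCg hf

/-- Linearity on the class: `K̄(f + c h) = K̄ f + c K̄ h` pointwise. -/
theorem hmcOpRandom_add_mul (J : Fin (n + 1) → Fin (n + 1) → ℝ) (lam δ : ℝ) (S : Finset ℕ)
    (w : ℕ → ℝ) {f h : (Fin (n + 1) → ℝ) → ℝ} (hf : PolyObs f) (hh : PolyObs h) (c : ℝ)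
    (φ : Fin (n + 1) → ℝ) :
    hmcOpRandom J lam δ S w (fun s => f s + c * h s) φ
      = hmcOpRandom J lam δ S w f φ + c * hmcOpRandom J lam δ S w h φ := by
  unfold hmcOpRandom
  rw [Finset.mul_sum, ← Finset.sum_add_distrib]
  refine Finset.sum_congr rfl fun N _ => ?_
  obtain ⟨C, hC1, hCg⟩ := hmcProposal_growth J lam δ N
  unfold hmcOpPhi4
  rw [hmcOpOf_add_mul_poly J lam (measurable_hmcProposal J lam δ N) (zero_le_one.trans hC1) hCg hf hh]
  ring

/-- `K̄ 1 = 1` (the weights sum to one). -/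
theorem hmcOpRandom_one (J : Fin (n + 1) → Fin (n + 1) → ℝ) (lam δ : ℝ) {S : Finset ℕ}
    {w : ℕ → ℝ} (hw1 : ∑ N ∈ S, w N = 1) (φ : Fin (n + 1) → ℝ) :
    hmcOpRandom J lam δ S w (fun _ => (1 : ℝ)) φ = 1 := by
  unfold hmcOpRandom hmcOpPhi4
  simp only [hmcOpOf_one, mul_one, hw1]

/-- **EXACTNESS of the randomised update**: `∫ (K̄ f) e^{−S} = ∫ f e^{−S}` for every `f ∈ PolyObs`
(coercive action; weights summing to one). -/
theorem hmcOpRandom_exact {J : Fin (n + 1) → Fin (n + 1) → ℝ} {lam ε K : ℝ} (hε : 0 < ε)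
    (hS : ∀ φ : Fin (n + 1) → ℝ, ε * ∑ x, φ x ^ 2 - K ≤ latticePhi4Action J lam φ)
    (δ : ℝ) {S : Finset ℕ} {w : ℕ → ℝ} (hw1 : ∑ N ∈ S, w N = 1)
    {f : (Fin (n + 1) → ℝ) → ℝ} (hf : PolyObs f) :
    ∫ φ, hmcOpRandom J lam δ S w f φ * gibbsWeight J lam φ = ∫ φ, f φ * gibbsWeight J lam φ := by
  have hfw : Integrable (fun φ => f φ * gibbsWeight J lam φ) :=
    (polyObs_integrable_mul_mul_gibbsWeight hε hS hf (polyObs_const 1)).congr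
      (Eventually.of_forall fun φ => by simp only [mul_one])
  have hI : ∀ N ∈ S, Integrable (fun φ => w N * hmcOpPhi4 J lam δ N f φ * gibbsWeight J lam φ) := by
    intro N _
    obtain ⟨C, hC1, hCg⟩ := hmcProposal_growth J lam δ N
    have hK : PolyObs (hmcOpPhi4 J lam δ N f) :=
      polyObs_hmcOpOf J lam (measurable_hmcProposal J lam δ N) (zero_le_one.trans hC1) hCg hf
    refine ((polyObs_integrable_mul_mul_gibbsWeight hε hS hK (polyObs_const 1)).const_mul (w N)).congr
      (Eventually.of_forall fun φ => ?_)
    simp only [mul_one]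
    ring
  unfold hmcOpRandom
  simp_rw [Finset.sum_mul]
  rw [integral_finsetSum S hI]
  have e : ∀ N ∈ S, ∫ φ, w N * hmcOpPhi4 J lam δ N f φ * gibbsWeight J lam φ
      = w N * ∫ φ, f φ * gibbsWeight J lam φ := by
    intro N _
    have h := hmc_exact_of_involutive (J := J) (lam := lam) (measurable_hmcProposal J lam δ N)
      (hmcProposal_involutive J lam δ N) (measurePreserving_hmcProposal J lam δ N) hf.1 hfw
    rw [← h, ← integral_const_mul]
    refine integral_congr_ae (Eventually.of_forall fun φ => ?_)
    show w N * hmcOpPhi4 J lam δ N f φ * gibbsWeight J lam φ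
      = w N * (hmcOpOf J lam (hmcProposal J lam δ N) f φ * gibbsWeight J lam φ)
    unfold hmcOpPhi4
    ring
  rw [Finset.sum_congr rfl e, ← Finset.sum_mul, hw1, one_mul]

/-- **REVERSIBILITY**: `∫ (K̄ f) h e^{−S} = ∫ f (K̄ h) e^{−S}` on `PolyObs` (coercive action, any weights). -/
theorem hmcOpRandom_reversible {J : Fin (n + 1) → Fin (n + 1) → ℝ} {lam ε K : ℝ} (hε : 0 < ε)
    (hS : ∀ φ : Fin (n + 1) → ℝ, ε * ∑ x, φ x ^ 2 - K ≤ latticePhi4Action J lam φ)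
    (δ : ℝ) (S : Finset ℕ) (w : ℕ → ℝ) {f h : (Fin (n + 1) → ℝ) → ℝ} (hf : PolyObs f)
    (hh : PolyObs h) :
    ∫ φ, hmcOpRandom J lam δ S w f φ * h φ * gibbsWeight J lam φ
      = ∫ φ, f φ * hmcOpRandom J lam δ S w h φ * gibbsWeight J lam φ := by
  have hKf : ∀ N, PolyObs (hmcOpPhi4 J lam δ N f) := fun N => by
    obtain ⟨C, hC1, hCg⟩ := hmcProposal_growth J lam δ N
    exact polyObs_hmcOpOf J lam (measurable_hmcProposal J lam δ N) (zero_le_one.trans hC1) hCg hf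
  have hKh : ∀ N, PolyObs (hmcOpPhi4 J lam δ N h) := fun N => by
    obtain ⟨C, hC1, hCg⟩ := hmcProposal_growth J lam δ N
    exact polyObs_hmcOpOf J lam (measurable_hmcProposal J lam δ N) (zero_le_one.trans hC1) hCg hh
  have hI1 : ∀ N ∈ S, Integrable (fun φ => w N * hmcOpPhi4 J lam δ N f φ * h φ * gibbsWeight J lam φ) :=
    fun N _ => ((polyObs_integrable_mul_mul_gibbsWeight hε hS (hKf N) hh).const_mul (w N)).congr
      (Eventually.of_forall fun φ => by ring)
  have hI2 : ∀ N ∈ S, Integrable (fun φ => f φ * (w N * hmcOpPhi4 J lam δ N h φ) * gibbsWeight J lam φ) :=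
    fun N _ => ((polyObs_integrable_mul_mul_gibbsWeight hε hS hf (hKh N)).const_mul (w N)).congr
      (Eventually.of_forall fun φ => by ring)
  unfold hmcOpRandom
  simp_rw [Finset.sum_mul, Finset.mul_sum, Finset.sum_mul]
  rw [integral_finsetSum S hI1, integral_finsetSum S hI2]
  refine Finset.sum_congr rfl fun N _ => ?_
  have hrev := hmc_reversible_poly hε hS (measurable_hmcProposal J lam δ N)
    (hmcProposal_involutive J lam δ N) (measurePreserving_hmcProposal J lam δ N) hf hh
  unfold hmcOpPhi4
  calc ∫ φ, w N * hmcOpOf J lam (hmcProposal J lam δ N) f φ * h φ * gibbsWeight J lam φ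
      = w N * ∫ φ, hmcOpOf J lam (hmcProposal J lam δ N) f φ * h φ * gibbsWeight J lam φ := by
        rw [← integral_const_mul]
        exact integral_congr_ae (Eventually.of_forall fun φ => by ring)
    _ = w N * ∫ φ, f φ * hmcOpOf J lam (hmcProposal J lam δ N) h φ * gibbsWeight J lam φ := by rw [hrev]
    _ = ∫ φ, f φ * (w N * hmcOpOf J lam (hmcProposal J lam δ N) h φ) * gibbsWeight J lam φ := by
        rw [← integral_const_mul]
        exact integral_congr_ae (Eventually.of_forall fun φ => by ring)

/-- Convexity: `(Σ_{N∈S} w_N a_N)² ≤ Σ_{N∈S} w_N a_N²` for weights `w_N ≥ 0` with `Σ w_N = 1`. -/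
theorem sq_weightedSum_le {S : Finset ℕ} {w : ℕ → ℝ} (hw0 : ∀ N, 0 ≤ w N)
    (hw1 : ∑ N ∈ S, w N = 1) (a : ℕ → ℝ) :
    (∑ N ∈ S, w N * a N) ^ 2 ≤ ∑ N ∈ S, w N * a N ^ 2 := by
  have h := Finset.sum_mul_sq_le_sq_mul_sq S (fun N => Real.sqrt (w N)) (fun N => Real.sqrt (w N) * a N)
  have e1 : ∀ N, Real.sqrt (w N) * (Real.sqrt (w N) * a N) = w N * a N := fun N => by
    rw [← mul_assoc, Real.mul_self_sqrt (hw0 N)]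
  have e2 : ∀ N, Real.sqrt (w N) ^ 2 = w N := fun N => Real.sq_sqrt (hw0 N)
  have e3 : ∀ N, (Real.sqrt (w N) * a N) ^ 2 = w N * a N ^ 2 := fun N => by
    rw [mul_pow, e2]
  simp only [e1, e2, e3, hw1, one_mul] at h
  exact h

/-- **`L²(e^{−S})`-CONTRACTION**: `∫ (K̄ f)² e^{−S} ≤ ∫ f² e^{−S}` on `PolyObs` (coercive action,
`w_N ≥ 0`, `Σ w_N = 1`). -/
theorem hmcOpRandom_contraction {J : Fin (n + 1) → Fin (n + 1) → ℝ} {lam ε K : ℝ} (hε : 0 < ε)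
    (hS : ∀ φ : Fin (n + 1) → ℝ, ε * ∑ x, φ x ^ 2 - K ≤ latticePhi4Action J lam φ)
    (δ : ℝ) {S : Finset ℕ} {w : ℕ → ℝ} (hw0 : ∀ N, 0 ≤ w N) (hw1 : ∑ N ∈ S, w N = 1)
    {f : (Fin (n + 1) → ℝ) → ℝ} (hf : PolyObs f) :
    ∫ φ, hmcOpRandom J lam δ S w f φ ^ 2 * gibbsWeight J lam φ ≤ ∫ φ, f φ ^ 2 * gibbsWeight J lam φ := by
  have hKf : ∀ N, PolyObs (hmcOpPhi4 J lam δ N f) := fun N => by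
    obtain ⟨C, hC1, hCg⟩ := hmcProposal_growth J lam δ N
    exact polyObs_hmcOpOf J lam (measurable_hmcProposal J lam δ N) (zero_le_one.trans hC1) hCg hf
  have hI : ∀ N ∈ S, Integrable (fun φ => w N * hmcOpPhi4 J lam δ N f φ ^ 2 * gibbsWeight J lam φ) :=
    fun N _ => ((polyObs_integrable_mul_mul_gibbsWeight hε hS (hKf N) (hKf N)).const_mul (w N)).congr
      (Eventually.of_forall fun φ => by ring)
  have hsum : Integrable (fun φ => (∑ N ∈ S, w N * hmcOpPhi4 J lam δ N f φ ^ 2) * gibbsWeight J lam φ) := by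
    simp_rw [Finset.sum_mul]
    exact integrable_finsetSum S hI
  -- pointwise convexity, then each `K_N` contracts
  calc ∫ φ, hmcOpRandom J lam δ S w f φ ^ 2 * gibbsWeight J lam φ
      ≤ ∫ φ, (∑ N ∈ S, w N * hmcOpPhi4 J lam δ N f φ ^ 2) * gibbsWeight J lam φ := by
        refine integral_mono_of_nonneg (Eventually.of_forall fun φ =>
          mul_nonneg (sq_nonneg _) (gibbsWeight_pos J lam φ).le) hsum (Eventually.of_forall fun φ => ?_)
        exact mul_le_mul_of_nonneg_right (sq_weightedSum_le hw0 hw1 _) (gibbsWeight_pos J lam φ).le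
    _ = ∑ N ∈ S, w N * ∫ φ, hmcOpPhi4 J lam δ N f φ ^ 2 * gibbsWeight J lam φ := by
        simp_rw [Finset.sum_mul]
        rw [integral_finsetSum S hI]
        refine Finset.sum_congr rfl fun N _ => ?_
        rw [← integral_const_mul]
        exact integral_congr_ae (Eventually.of_forall fun φ => by ring)
    _ ≤ ∑ N ∈ S, w N * ∫ φ, f φ ^ 2 * gibbsWeight J lam φ := by
        refine Finset.sum_le_sum fun N _ => mul_le_mul_of_nonneg_left ?_ (hw0 N)
        obtain ⟨C, hC1, hCg⟩ := hmcProposal_growth J lam δ N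
        exact hmcOpOf_contraction_poly hε hS (measurable_hmcProposal J lam δ N)
          (hmcProposal_involutive J lam δ N) (measurePreserving_hmcProposal J lam δ N)
          (zero_le_one.trans hC1) hCg hf
    _ = ∫ φ, f φ ^ 2 * gibbsWeight J lam φ := by rw [← Finset.sum_mul, hw1, one_mul]

/-! ## The integrated carré du champ of the randomised update -/

/-- Expansion of the squared-deviation observable through a single update:
`K[(g − g φ)²](φ) = K(g²)(φ) − 2 g(φ) (K g)(φ) + g(φ)²` (`g ∈ PolyObs`, polynomial growth of `Ψ`). -/
theorem hmcOpOf_sqdev_expand (J : Fin (n + 1) → Fin (n + 1) → ℝ) (lam : ℝ)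
    {Ψ : (Fin (n + 1) → ℝ) × (Fin (n + 1) → ℝ) → (Fin (n + 1) → ℝ) × (Fin (n + 1) → ℝ)}
    (hΨm : Measurable Ψ) {C : ℝ} {m : ℕ} (hC : 0 ≤ C)
    (hΨg : ∀ z, phaseSize (Ψ z) ≤ C * phaseSize z ^ m)
    {g : (Fin (n + 1) → ℝ) → ℝ} (hg : PolyObs g) (φ : Fin (n + 1) → ℝ) :
    hmcOpOf J lam Ψ (fun y => (g y - g φ) ^ 2) φ
      = hmcOpOf J lam Ψ (fun y => g y ^ 2) φ - 2 * g φ * hmcOpOf J lam Ψ g φ + g φ ^ 2 := by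
  have e : (fun y => (g y - g φ) ^ 2)
      = fun y => (g y ^ 2 + (-2 * g φ) * g y) + g φ ^ 2 * (fun _ => (1 : ℝ)) y := by
    funext y
    ring
  rw [e, hmcOpOf_add_mul_poly J lam hΨm hC hΨg (polyObs_add_mul (polyObs_sq hg) hg _) (polyObs_const 1),
    hmcOpOf_add_mul_poly J lam hΨm hC hΨg (polyObs_sq hg) hg, hmcOpOf_one]
  ring

/-- Hence `φ ↦ K[(g − g φ)²](φ) e^{−S(φ)}` is integrable (coercive action). -/
theorem integrable_hmcOpOf_sqdev {J : Fin (n + 1) → Fin (n + 1) → ℝ} {lam ε K : ℝ} (hε : 0 < ε)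
    (hS : ∀ φ : Fin (n + 1) → ℝ, ε * ∑ x, φ x ^ 2 - K ≤ latticePhi4Action J lam φ)
    {Ψ : (Fin (n + 1) → ℝ) × (Fin (n + 1) → ℝ) → (Fin (n + 1) → ℝ) × (Fin (n + 1) → ℝ)}
    (hΨm : Measurable Ψ) {C : ℝ} {m : ℕ} (hC : 0 ≤ C)
    (hΨg : ∀ z, phaseSize (Ψ z) ≤ C * phaseSize z ^ m)
    {g : (Fin (n + 1) → ℝ) → ℝ} (hg : PolyObs g) :
    Integrable (fun φ => hmcOpOf J lam Ψ (fun y => (g y - g φ) ^ 2) φ * gibbsWeight J lam φ) := by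
  have h1 := polyObs_integrable_mul_mul_gibbsWeight hε hS (polyObs_hmcOpOf J lam hΨm hC hΨg (polyObs_sq hg))
    (polyObs_const 1)
  have h2 := polyObs_integrable_mul_mul_gibbsWeight hε hS hg (polyObs_hmcOpOf J lam hΨm hC hΨg hg)
  have h3 := polyObs_integrable_mul_mul_gibbsWeight hε hS hg hg
  refine ((h1.sub (h2.const_mul 2)).add h3).congr (Eventually.of_forall fun φ => ?_)
  simp only [Pi.add_apply, Pi.sub_apply, hmcOpOf_sqdev_expand J lam hΨm hC hΨg hg φ]
  ring

/-- **THE INTEGRATED CARRÉ DU CHAMP OF THE RANDOMISED UPDATE IS THE `w`-AVERAGE OF THE PHASE-SPACE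
MEAN SQUARED ACCEPTED JUMPS**:
`∫ K̄[(g − g φ)²](φ) e^{−S} = Σ_N w_N (∫∫ a_N (g((Ψ_N z).1) − g(z.1))² e^{−H}) / Z_p`. -/
theorem hmcOpRandom_carre_eq {J : Fin (n + 1) → Fin (n + 1) → ℝ} {lam ε K : ℝ} (hε : 0 < ε)
    (hS : ∀ φ : Fin (n + 1) → ℝ, ε * ∑ x, φ x ^ 2 - K ≤ latticePhi4Action J lam φ)
    (δ : ℝ) (S : Finset ℕ) (w : ℕ → ℝ) {g : (Fin (n + 1) → ℝ) → ℝ} (hg : PolyObs g) :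
    ∫ φ, hmcOpRandom J lam δ S w (fun y => (g y - g φ) ^ 2) φ * gibbsWeight J lam φ
      = ∑ N ∈ S, w N * ((∫ z, involAccept (phi4HmcEnergy J lam) (hmcProposal J lam δ N) z
          * (g (hmcProposal J lam δ N z).1 - g z.1) ^ 2 * Real.exp (-phi4HmcEnergy J lam z)
            ∂((volume : Measure (Fin (n + 1) → ℝ)).prod volume)) / momentumZ n) := by
  have hI : ∀ N ∈ S, Integrable (fun φ => w N * hmcOpPhi4 J lam δ N (fun y => (g y - g φ) ^ 2) φ
      * gibbsWeight J lam φ) := by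
    intro N _
    obtain ⟨C, hC1, hCg⟩ := hmcProposal_growth J lam δ N
    refine ((integrable_hmcOpOf_sqdev hε hS (measurable_hmcProposal J lam δ N) (zero_le_one.trans hC1)
      hCg hg).const_mul (w N)).congr (Eventually.of_forall fun φ => ?_)
    unfold hmcOpPhi4
    ring
  unfold hmcOpRandom
  simp_rw [Finset.sum_mul]
  rw [integral_finsetSum S hI]
  refine Finset.sum_congr rfl fun N _ => ?_
  rw [← integral_hmcOpOf_sq_dev_eq_poly hε hS (measurable_hmcProposal J lam δ N)
    (measurePreserving_hmcProposal J lam δ N) hg, ← integral_const_mul]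
  refine integral_congr_ae (Eventually.of_forall fun φ => ?_)
  unfold hmcOpPhi4
  ring

/-- **THE AVERAGED MEAN-SQUARED-JUMP FLOOR FOR RANDOMISED TRAJECTORY LENGTHS.**  Coercive action (any
real `λ`, `J`), `w_N ≥ 0` with `Σ_{N∈S} w_N = 1`, `f ∈ PolyObs`, `g = f − ⟨f⟩`.  If for every `N ∈ S`
`∫∫ a_N (f((Ψ_N z).1) − f(z.1))² e^{−H} ≤ D_N · Z_p · Z`, and the autocorrelations of `g` under
`K̄ = hmcOpRandom J λ δ S w` are summable with `ρ_g(1) < 1`, then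
`τ_int(f) ≥ 2 Var(f)/(Σ_N w_N D_N) − ½`. -/
theorem hmcRandom_tauInt_ge_of_msd_le {J : Fin (n + 1) → Fin (n + 1) → ℝ} {lam ε K : ℝ}
    (hε : 0 < ε) (hS : ∀ φ : Fin (n + 1) → ℝ, ε * ∑ x, φ x ^ 2 - K ≤ latticePhi4Action J lam φ)
    (δ : ℝ) {S : Finset ℕ} {w : ℕ → ℝ} (hw0 : ∀ N, 0 ≤ w N) (hw1 : ∑ N ∈ S, w N = 1)
    {f : (Fin (n + 1) → ℝ) → ℝ} (hf : PolyObs f) {D : ℕ → ℝ}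
    (hD : ∀ N ∈ S, ∫ z, involAccept (phi4HmcEnergy J lam) (hmcProposal J lam δ N) z
        * (f (hmcProposal J lam δ N z).1 - f z.1) ^ 2 * Real.exp (-phi4HmcEnergy J lam z)
          ∂((volume : Measure (Fin (n + 1) → ℝ)).prod volume)
        ≤ D N * (momentumZ n * gibbsZ J lam))
    (hs : Summable fun k => (∫ φ, (f φ - gibbsExpect J lam f)
        * ((hmcOpRandom J lam δ S w)^[k + 1] (fun ψ => f ψ - gibbsExpect J lam f)) φ
        * gibbsWeight J lam φ)
        / ∫ φ, (f φ - gibbsExpect J lam f) ^ 2 * gibbsWeight J lam φ)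
    (hρ : (∫ φ, (f φ - gibbsExpect J lam f)
        * hmcOpRandom J lam δ S w (fun ψ => f ψ - gibbsExpect J lam f) φ * gibbsWeight J lam φ)
        / (∫ φ, (f φ - gibbsExpect J lam f) ^ 2 * gibbsWeight J lam φ) < 1) :
    2 * gibbsExpect J lam (fun φ => (f φ - gibbsExpect J lam f) ^ 2) / (∑ N ∈ S, w N * D N) - 1 / 2
      ≤ tauInt (fun k => (∫ φ, (f φ - gibbsExpect J lam f)
          * ((hmcOpRandom J lam δ S w)^[k] (fun ψ => f ψ - gibbsExpect J lam f)) φ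
          * gibbsWeight J lam φ)
          / ∫ φ, (f φ - gibbsExpect J lam f) ^ 2 * gibbsWeight J lam φ) := by
  have hZ := gibbsZ_pos_of_coercive hε hS
  have hZp := momentumZ_pos n
  have hg : PolyObs (fun ψ => f ψ - gibbsExpect J lam f) := polyObs_sub_const hf _
  set Dbar : ℝ := ∑ N ∈ S, w N * D N with hDbar
  have hΓ : ∫ φ, hmcOpRandom J lam δ S w (fun ψ => ((f ψ - gibbsExpect J lam f)
      - (f φ - gibbsExpect J lam f)) ^ 2) φ * gibbsWeight J lam φ ≤ Dbar * gibbsZ J lam := by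
    rw [hmcOpRandom_carre_eq hε hS δ S w hg, hDbar, Finset.sum_mul]
    refine Finset.sum_le_sum fun N hN => ?_
    have e : ∀ z : (Fin (n + 1) → ℝ) × (Fin (n + 1) → ℝ),
        involAccept (phi4HmcEnergy J lam) (hmcProposal J lam δ N) z
          * ((f (hmcProposal J lam δ N z).1 - gibbsExpect J lam f) - (f z.1 - gibbsExpect J lam f)) ^ 2
          * Real.exp (-phi4HmcEnergy J lam z)
        = involAccept (phi4HmcEnergy J lam) (hmcProposal J lam δ N) z
          * (f (hmcProposal J lam δ N z).1 - f z.1) ^ 2 * Real.exp (-phi4HmcEnergy J lam z) :=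
      fun z => by ring
    simp_rw [e]
    rw [mul_assoc]
    refine mul_le_mul_of_nonneg_left ?_ (hw0 N)
    rw [div_le_iff₀ hZp]
    calc _ ≤ D N * (momentumZ n * gibbsZ J lam) := hD N hN
      _ = D N * gibbsZ J lam * momentumZ n := by ring
  have hfloor := RevOp.tauInt_ge_of_integral_carre_le (μ := volume) (A := PolyObs)
    (K := hmcOpRandom J lam δ S w) (w := gibbsWeight J lam)
    (fun φ => (gibbsWeight_pos J lam φ).le) (polyObs_const 1)
    (fun f h hf hh => polyObs_integrable_mul_mul_gibbsWeight hε hS hf hh)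
    (fun f h c hf hh => polyObs_add_mul hf hh c)
    (fun f hf => polyObs_hmcOpRandom J lam δ S w hf)
    (fun f h c hf hh x => hmcOpRandom_add_mul J lam δ S w hf hh c x)
    (fun f h hf hh => hmcOpRandom_reversible hε hS δ S w hf hh)
    (fun f hf => hmcOpRandom_contraction hε hS δ hw0 hw1 hf)
    (fun φ => hmcOpRandom_one J lam δ hw1 φ) hg (polyObs_sq hg) hΓ hs hρ
  have e : ∀ P : ℝ, 2 * (P / gibbsZ J lam) / Dbar - 1 / 2 = 2 * P / (Dbar * gibbsZ J lam) - 1 / 2 := by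
    intro P
    rw [mul_div_assoc, div_div, mul_comm (gibbsZ J lam) Dbar, ← mul_div_assoc]
  unfold gibbsExpect
  exact (e _).le.trans hfloor

end Random

end Summit.Ventures.LatticeQCDFlow.Exactness
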